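import Literature.NumberTheory.GaloisCohomology.Howard2004.DVRLevelPairingPackageProofs
import Literature.NumberTheory.GaloisCohomology.Howard2004.DVRLevelSelmerFiniteProofs
import HarnessLib

/-!
# Howard 2004, Thm. 1.4.2 (proof, p. 1449): the level package and Thm. 1.6.1 from the SKEW pairings
# `( , )_{s,1} : ℋ[𝔪^s] × ℋ[𝔪] → R[𝔪]` of Prop. 1.4.1 — proofs file

Topic `NumberTheory/GaloisCohomology/Howard2004`. THEOREMS ONLY: no definition, no named fact, no instance, no
notation, no `sorry`. Sequel of `DVRLevelPairingPackageProofs` (x10b-p1-w7 g6, p690450: the levelwise structure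
package of Howard's Thm. 1.6.1 from ALTERNATING level forms `B_{k,t}` on `H¹_𝓕(K, T^{(k)})[π^{t+1}]` with kernel
exactly `H¹_𝓕[π^t] + π·H¹_𝓕[π^{t+2}]`) and `DVRLevelSelmerFiniteProofs` (the level Selmer groups are finite).
Cell `pub/bsd-print-x9`, seat `bsd-line-x9-p1` LEAD g9; print leaf G87 =
`Literature.NumberTheory.GaloisCohomology.Howard2004.thm161_dvrKolyvaginBound` (Howard Thm. 1.6.1), registered
pseudo-stub `stub_h161` of the μ-crux `MuInequalityCoherentPair` (stmt-BirchSwinnertonDyer-22642).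

SOURCE, verbatim. B. Howard, *The Heegner point Kolyvagin system*, Compositio Math. **140** (2004) 1439–1472,
proof of Thm. 1.4.2 (= arXiv:1202.6340 Thm. 2.4.2, held text p0008 L100–L141): «Abbreviate `ℋ = H¹_𝓕(K,T)`, and
for `1 ≤ s < k` define `V_s = ℋ[𝔪^s]/𝔪ℋ[𝔪^{s+1}]`, `W_s = ℋ[𝔪]/𝔪^s ℋ[𝔪^{s+1}]`. […] Using hypothesis H.4 and
Lemma 1.3.3, we may identify `H¹_{𝓕*}(K, T*[𝔪]) ≅ H¹_𝓕(K, T[𝔪]) ≅ ℋ[𝔪]` and `H¹_𝓕(K, T/𝔪^sT) ≅ ℋ[𝔪^s]`.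
Proposition 1.4.1 therefore gives a nondegenerate pairing of `R/𝔪`-vector spaces
`( , )_{s,1} : V_s × W_s ≅ ℋ[𝔪^s]/𝔪ℋ[𝔪^{s+1}] × ℋ[𝔪]/𝔪^sℋ[𝔪^{s+1}] → R[𝔪]`. We define a pairing
`⟨ , ⟩ : V_s × V_s → R[𝔪]` by `⟨a, b⟩ = (a, π^{s-1}b)_{s,1}`. The kernel on the right is `V_{s-1}`. If we can show
that this pairing is alternating, then `V_s/V_{s-1}` is even dimensional for every `1 ≤ s < k`, and the claim
follows. To check that this is alternating we must verify `(a, π^{s-1}b)_{s,1} = -(b, π^{s-1}a)_{s,1}`.» (the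
verification is p0008 L142 – p0009 L55: Flach's construction, the tensor-square resolution, the reciprocity law
and the self-orthogonality of `𝓕`).

WHAT IS PROVED HERE. The consumer `DVRSetting.exists_package_of_levelPairings` / `conclusion_of_levelPairings`
takes the Galois-cohomological input in an ALREADY DIGESTED form: alternating forms `B_{k,t}` on the ONE module
`H¹_𝓕(K,T^{(k)})[π^{t+1}]` with prescribed kernel. This file performs, in the kernel, the step of the display
above that turns Howard's PRINTED objects into those forms, so that the remaining printed input of G87 on this
side is EXACTLY the displayed sentence, stated on `ℋ = H¹_𝓕(K, T^{(k)})` alone (no `T*`, no `𝓕*`, no second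
module `T/𝔪^sT`, no Lemma 1.3.3): for each level `k` and each `s = t + 1 < e_k`,
* a pairing `P_{k,t} : ℋ[π^{t+1}] × ℋ[π] → Q_{k,t}` (`Q_{k,t}` an `R`-module with cyclic `π`-torsion; Howard:
  `R[𝔪] ≅ R/𝔪`), additive and `R`-equivariant in both slots (`( , )_{s,1}`);
* «nondegenerate on `W_s`»: the RIGHT kernel of `P_{k,t}` is exactly `π^{t+1}·ℋ[π^{t+2}]` (`= 𝔪^s ℋ[𝔪^{s+1}]`);
* SKEW-SYMMETRY «`(a, π^{s-1}b)_{s,1} = -(b, π^{s-1}a)_{s,1}`»: `P_{k,t}(a, π^t b) = - P_{k,t}(b, π^t a)`.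
From these (the LEFT-kernel clause «nondegenerate on `V_s`» is not even needed):
* §1 `isUnit_two_base` (`2 ∈ R^×`, `p` odd), `scalarMapH1_pow_mem_inf_ker` / `…_selmer_inf_ker`
  (`b ∈ L[π^{t+1}] ⇒ π^t b ∈ L[π]` for an `R`-stable `L ≤ H¹(K,T^{(k)})`), `scalarMapH1_comm` (bookkeeping);
* §2 **`levelForms_of_skewPairings`** (GENERIC: any `R`-stable subgroup `L ≤ H¹(K, T^{(k)})` — so that the sequel
  can apply it to the modified Selmer groups `H¹_{𝓕(n)}(K, T^{(k)})` of §1.5) and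
  **`exists_levelPairings_of_skewPairings`** (`L = H¹_𝓕(K,T^{(k)})`, all levels) — the forms
  `B_{k,t}(a,b) := P_{k,t}(a, π^t b)` («`⟨a,b⟩ = (a, π^{s-1}b)_{s,1}`») satisfy EXACTLY the binders
  `hB₁ / hB₂ / halt / hker` of `exists_package_of_levelPairings`: `R`-equivariance; ALTERNATING (skew-symmetry and
  `2 ∈ R^×`); kernel `= ℋ[π^t] + π·ℋ[π^{t+2}]` («The kernel on the right is `V_{s-1}`»: by skew-symmetry
  `B(x, ·) = 0` iff `π^t x` lies in the right kernel of `P`, iff `π^t x = π^{t+1} z` with `z ∈ ℋ[π^{t+2}]`, iff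
  `x = (x - πz) + πz` with `x - πz ∈ ℋ[π^t]`);
* §3 **`exists_package_of_skewPairings`** (the levelwise package `H¹_𝓕(K,T^{(k)}) ≅ (R/𝔪^{e_k})^ε × (M_k × M_k)`,
  ONE `ε ≤ 1`) and **`conclusion_of_skewPairings`** — Howard's Thm. 1.6.1 conclusion record `S.Conclusion hy κ.one`
  from {the skew pairings above, Lemma 1.6.4 at `n = 1` (for any admissible decomposition), `κ_1 ≠ 0`}; the
  finiteness of the level Selmer groups is DISCHARGED (`finite_selmerGroup`).

HONEST FRAMING: Howard's Prop. 1.4.1 (Flach's generalized Cassels–Tate pairing) and the skew-symmetry identity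
are NOT proved here — they are the hypotheses `P / hP₁ / hP₂ / hright / hskew`, to be supplied by name by a
printed input; `thm161_dvrKolyvaginBound` is NOT proved here; no summit statement is proved; the
Birch–Swinnerton-Dyer conjecture is not proved by any of this.

References: [Howard2004HeegnerKolyvagin] Prop. 1.4.1, Thm. 1.4.2 (proof), Thm. 1.6.1 (arXiv:1202.6340 pp. 8–9, 11–12);
[Flach1990] M. Flach, *A generalisation of the Cassels–Tate pairing*, J. reine angew. Math. 412 (1990) 113–127.
-/

set_option autoImplicit false

noncomputable section

open Function NumberField IsDedekindDomain Field Module Submodule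
open scoped NumberField ContRepresentation Pointwise

namespace Literature.NumberTheory.GaloisCohomology.Howard2004

open Literature.NumberTheory.GaloisRepresentations
open Literature.NumberTheory.GaloisRepresentations.DiscreteGaloisModule

namespace DVRSetting

variable {p : ℕ} [Fact p.Prime] {K : Type} [Field K] [NumberField K]
  {R : Type} [CommRing R] [IsDomain R] [IsDiscreteValuationRing R] [Algebra ℤ_[p] R]
  {N : ℕ → Type} [∀ k, AddCommGroup (N k)] [∀ k, TopologicalSpace (N k)]
  [∀ k, DiscreteTopology (N k)] [∀ k, Module R (N k)]
  {Rk : ℕ → Type} [∀ k, CommRing (Rk k)] [∀ k, IsLocalRing (Rk k)] [∀ k, TopologicalSpace (Rk k)]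
  [∀ k, DiscreteTopology (Rk k)] [∀ k, Algebra ℤ_[p] (Rk k)] [∀ k, Algebra R (Rk k)]
  [∀ k, Module (Rk k) (N k)] [∀ k, IsScalarTower R (Rk k) (N k)]
  {Nbar : Type} [AddCommGroup Nbar] [TopologicalSpace Nbar] [DiscreteTopology Nbar]
  [∀ k, Module (Rk k) Nbar]
  {Nq : ℕ → Finset (HeightOneSpectrum (𝓞 K)) → Type} [∀ k n, AddCommGroup (Nq k n)]
  [∀ k n, TopologicalSpace (Nq k n)] [∀ k n, DiscreteTopology (Nq k n)]
  [∀ k n, Module (Rk k) (Nq k n)] [∀ k n, Module R (Nq k n)]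
  [∀ k n, IsScalarTower R (Rk k) (Nq k n)]

/-! ## §1 Bookkeeping: `2 ∈ R^×`; `π^t` carries `ℋ[π^{t+1}]` into `ℋ[π]`; the scalar maps commute -/

/-- **`2` is a unit of the coefficient DVR `R`** (`p` odd and the residue field has characteristic `p`).
[cite: Howard2004HeegnerKolyvagin, §1 conventions (arXiv:1202.6340 p. 4 L47–52) and journal §1 (p odd)] -/
theorem isUnit_two_base (S : DVRSetting p K R N Rk Nbar Nq) (hy : S.SatisfiesH) : IsUnit (2 : R) := by
  by_contra h
  have hmem : (2 : R) ∈ IsLocalRing.maximalIdeal R :=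
    (IsLocalRing.mem_maximalIdeal _).mpr (mem_nonunits_iff.mpr h)
  haveI := hy.coeffRing.charP_residueField
  have h0 : ((2 : ℕ) : IsLocalRing.ResidueField R) = 0 := by
    rw [Nat.cast_ofNat, ← map_ofNat (IsLocalRing.residue R) 2, IsLocalRing.residue_eq_zero_iff]
    exact hmem
  have hdvd : p ∣ 2 := (CharP.cast_eq_zero_iff (IsLocalRing.ResidueField R) p 2).mp h0
  have hp : p.Prime := Fact.out
  exact hy.p_odd (le_antisymm (Nat.le_of_dvd two_pos hdvd) hp.two_le)

/-- The scalar maps `H¹(r•)` and `H¹(s•)` on `H¹(K, T^{(k)})` commute (`R` is commutative).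
[cite: Howard2004HeegnerKolyvagin, §1 conventions (Mod_{R,K}) and Def. 1.1.1 (arXiv:1202.6340 p0005 L3–24)] -/
theorem scalarMapH1_comm (S : DVRSetting p K R N Rk Nbar Nq) (k : ℕ) (r s : R)
    (x : galoisCohomology (S.T.ρ k) 1) :
    galoisCohomology.scalarMapH1 (S.T.ρ k) (S.T.hlin k) r
        (galoisCohomology.scalarMapH1 (S.T.ρ k) (S.T.hlin k) s x) =
      galoisCohomology.scalarMapH1 (S.T.ρ k) (S.T.hlin k) s
        (galoisCohomology.scalarMapH1 (S.T.ρ k) (S.T.hlin k) r x) := by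
  rw [← AddMonoidHom.comp_apply, ← galoisCohomology.scalarMapH1_mul, mul_comm,
    galoisCohomology.scalarMapH1_mul, AddMonoidHom.comp_apply]

/-- **`π^t` carries `L[π^{t+1}] = L ⊓ ker π^{t+1}` into `L[π] = L ⊓ ker π`** for any `R`-stable subgroup
`L ≤ H¹(K, T^{(k)})` (Howard's `b ↦ π^{s-1}b`, `V_s → W_s`, on `ℋ = H¹_𝓕(K,T^{(k)})`): `π·(π^t b) = π^{t+1} b = 0`.
[cite: Howard2004HeegnerKolyvagin, Thm. 1.4.2 (proof) (arXiv:1202.6340 p0008 L132–L135)] -/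
theorem scalarMapH1_pow_mem_inf_ker (S : DVRSetting p K R N Rk Nbar Nq) (k t : ℕ)
    (L : AddSubgroup (galoisCohomology (S.T.ρ k) 1))
    (hL : ∀ (r : R) {x : galoisCohomology (S.T.ρ k) 1}, x ∈ L →
      galoisCohomology.scalarMapH1 (S.T.ρ k) (S.T.hlin k) r x ∈ L)
    {b : galoisCohomology (S.T.ρ k) 1}
    (hb : b ∈ L ⊓ (galoisCohomology.scalarMapH1 (S.T.ρ k) (S.T.hlin k) (S.π ^ (t + 1))).ker) :
    galoisCohomology.scalarMapH1 (S.T.ρ k) (S.T.hlin k) (S.π ^ t) b ∈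
      L ⊓ (galoisCohomology.scalarMapH1 (S.T.ρ k) (S.T.hlin k) S.π).ker := by
  obtain ⟨hb₁, hb₂⟩ := AddSubgroup.mem_inf.1 hb
  refine AddSubgroup.mem_inf.2 ⟨hL _ hb₁, ?_⟩
  rw [AddMonoidHom.mem_ker] at hb₂ ⊢
  rw [← AddMonoidHom.comp_apply, ← galoisCohomology.scalarMapH1_mul, ← pow_succ', hb₂]

/-- The case `L = H¹_𝓕(K, T^{(k)})`: `π^t` carries `ℋ[π^{t+1}]` into `ℋ[π]`.
[cite: Howard2004HeegnerKolyvagin, Thm. 1.4.2 (proof) (arXiv:1202.6340 p0008 L132–L135)] -/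
theorem scalarMapH1_pow_mem_selmer_inf_ker (S : DVRSetting p K R N Rk Nbar Nq) (hy : S.SatisfiesH)
    (k t : ℕ) {b : galoisCohomology (S.T.ρ k) 1}
    (hb : b ∈ ((S.t k).cond).selmerGroup ⊓
      (galoisCohomology.scalarMapH1 (S.T.ρ k) (S.T.hlin k) (S.π ^ (t + 1))).ker) :
    galoisCohomology.scalarMapH1 (S.T.ρ k) (S.T.hlin k) (S.π ^ t) b ∈
      ((S.t k).cond).selmerGroup ⊓ (galoisCohomology.scalarMapH1 (S.T.ρ k) (S.T.hlin k) S.π).ker :=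
  S.scalarMapH1_pow_mem_inf_ker k t _ (fun r _ hx ↦ S.scalarMapH1_mem_selmerGroup hy k r hx) hb

/-! ## §2 The alternating level forms `B_{k,t}(a, b) = P_{k,t}(a, π^t b)` from the skew pairings -/

/-- **HOWARD'S `⟨a, b⟩ = (a, π^{s-1} b)_{s,1}` IS AN ALTERNATING FORM WITH KERNEL `V_{s-1}` — generic form, for ANY
`R`-stable subgroup `L ≤ H¹(K, T^{(k)})`** (applied below to `L = H¹_𝓕(K,T^{(k)})`, and by the sequel to the
modified Selmer groups `H¹_{𝓕(n)}(K,T^{(k)})` of Howard's §1.5). Data: for every `t` a bi-additive pairing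
`P_t : L[π^{t+1}] × L[π] → Q_t`, `R`-equivariant in both slots, such that for `t + 1 < e_k`: (right kernel)
`P_t(·, w) = 0` iff `w = π^{t+1} z` with `z ∈ L` killed by `π^{t+2}`, and (skew-symmetry)
`P_t(a, π^t b) = -P_t(b, π^t a)`. Then `B_t(a, b) := P_t(a, π^t b)` on `L[π^{t+1}]` is `R`-equivariant, ALTERNATING
(for `t + 1 < e_k`, via `2 ∈ R^×`) and has kernel EXACTLY `L[π^t] + π·L[π^{t+2}]`: by skew-symmetry `B_t(x, ·) = 0`
iff `π^t x` lies in the right kernel of `P_t`, iff `π^t x = π^{t+1} z`, iff `x = (x - πz) + πz` with `x - πz ∈ L[π^t]`.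
[cite: Howard2004HeegnerKolyvagin, Thm. 1.4.2 (proof) and Prop. 1.4.1 (arXiv:1202.6340 p0008 L83–L141)] -/
theorem levelForms_of_skewPairings (S : DVRSetting p K R N Rk Nbar Nq) (hy : S.SatisfiesH) (k : ℕ)
    (L : AddSubgroup (galoisCohomology (S.T.ρ k) 1))
    (hL : ∀ (r : R) {x : galoisCohomology (S.T.ρ k) 1}, x ∈ L →
      galoisCohomology.scalarMapH1 (S.T.ρ k) (S.T.hlin k) r x ∈ L)
    {Q : ℕ → Type} [∀ t, AddCommGroup (Q t)] [∀ t, Module R (Q t)]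
    (P : ∀ t, ↥(L ⊓ (galoisCohomology.scalarMapH1 (S.T.ρ k) (S.T.hlin k) (S.π ^ (t + 1))).ker) →+
      ↥(L ⊓ (galoisCohomology.scalarMapH1 (S.T.ρ k) (S.T.hlin k) S.π).ker) →+ Q t)
    (hP₁ : ∀ t (r : R) (x x' : ↥(L ⊓ (galoisCohomology.scalarMapH1 (S.T.ρ k) (S.T.hlin k) (S.π ^ (t + 1))).ker))
        (w : ↥(L ⊓ (galoisCohomology.scalarMapH1 (S.T.ρ k) (S.T.hlin k) S.π).ker)),
      (x' : galoisCohomology (S.T.ρ k) 1) =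
        galoisCohomology.scalarMapH1 (S.T.ρ k) (S.T.hlin k) r (x : galoisCohomology (S.T.ρ k) 1) →
      P t x' w = r • P t x w)
    (hP₂ : ∀ t (r : R) (x : ↥(L ⊓ (galoisCohomology.scalarMapH1 (S.T.ρ k) (S.T.hlin k) (S.π ^ (t + 1))).ker))
        (w w' : ↥(L ⊓ (galoisCohomology.scalarMapH1 (S.T.ρ k) (S.T.hlin k) S.π).ker)),
      (w' : galoisCohomology (S.T.ρ k) 1) =
        galoisCohomology.scalarMapH1 (S.T.ρ k) (S.T.hlin k) r (w : galoisCohomology (S.T.ρ k) 1) →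
      P t x w' = r • P t x w)
    (hright : ∀ t, t + 1 < S.e k → ∀ w : ↥(L ⊓ (galoisCohomology.scalarMapH1 (S.T.ρ k) (S.T.hlin k) S.π).ker),
      (∀ x, P t x w = 0) ↔
        ∃ z ∈ L, galoisCohomology.scalarMapH1 (S.T.ρ k) (S.T.hlin k) (S.π ^ (t + 2)) z = 0 ∧
          (w : galoisCohomology (S.T.ρ k) 1) =
            galoisCohomology.scalarMapH1 (S.T.ρ k) (S.T.hlin k) (S.π ^ (t + 1)) z)
    (hskew : ∀ t, t + 1 < S.e k →
      ∀ (a b : ↥(L ⊓ (galoisCohomology.scalarMapH1 (S.T.ρ k) (S.T.hlin k) (S.π ^ (t + 1))).ker))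
        (a' b' : ↥(L ⊓ (galoisCohomology.scalarMapH1 (S.T.ρ k) (S.T.hlin k) S.π).ker)),
      (a' : galoisCohomology (S.T.ρ k) 1) =
        galoisCohomology.scalarMapH1 (S.T.ρ k) (S.T.hlin k) (S.π ^ t) (a : galoisCohomology (S.T.ρ k) 1) →
      (b' : galoisCohomology (S.T.ρ k) 1) =
        galoisCohomology.scalarMapH1 (S.T.ρ k) (S.T.hlin k) (S.π ^ t) (b : galoisCohomology (S.T.ρ k) 1) →
      P t a b' = - P t b a') :
    ∃ B : ∀ t, ↥(L ⊓ (galoisCohomology.scalarMapH1 (S.T.ρ k) (S.T.hlin k) (S.π ^ (t + 1))).ker) →+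
      ↥(L ⊓ (galoisCohomology.scalarMapH1 (S.T.ρ k) (S.T.hlin k) (S.π ^ (t + 1))).ker) →+ Q t,
      (∀ t (r : R) (x x' y : ↥(L ⊓ (galoisCohomology.scalarMapH1 (S.T.ρ k) (S.T.hlin k) (S.π ^ (t + 1))).ker)),
        (x' : galoisCohomology (S.T.ρ k) 1) =
          galoisCohomology.scalarMapH1 (S.T.ρ k) (S.T.hlin k) r (x : galoisCohomology (S.T.ρ k) 1) →
        B t x' y = r • B t x y) ∧
      (∀ t (r : R) (x y y' : ↥(L ⊓ (galoisCohomology.scalarMapH1 (S.T.ρ k) (S.T.hlin k) (S.π ^ (t + 1))).ker)),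
        (y' : galoisCohomology (S.T.ρ k) 1) =
          galoisCohomology.scalarMapH1 (S.T.ρ k) (S.T.hlin k) r (y : galoisCohomology (S.T.ρ k) 1) →
        B t x y' = r • B t x y) ∧
      (∀ t, t + 1 < S.e k → ∀ x, B t x x = 0) ∧
      (∀ t, t + 1 < S.e k → ∀ x : ↥(L ⊓ (galoisCohomology.scalarMapH1 (S.T.ρ k) (S.T.hlin k) (S.π ^ (t + 1))).ker),
        (∀ y, B t x y = 0) ↔
          ∃ y ∈ L, ∃ z ∈ L,
            galoisCohomology.scalarMapH1 (S.T.ρ k) (S.T.hlin k) (S.π ^ t) y = 0 ∧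
            galoisCohomology.scalarMapH1 (S.T.ρ k) (S.T.hlin k) (S.π ^ (t + 2)) z = 0 ∧
            (x : galoisCohomology (S.T.ρ k) 1) =
              y + galoisCohomology.scalarMapH1 (S.T.ρ k) (S.T.hlin k) S.π z) := by
  -- abbreviations
  have htwo := S.isUnit_two_base hy
  -- `π^t : L[π^{t+1}] → L[π]` as an additive map, per `t`
  let toW : ∀ t, ↥(L ⊓ (galoisCohomology.scalarMapH1 (S.T.ρ k) (S.T.hlin k) (S.π ^ (t + 1))).ker) →+
      ↥(L ⊓ (galoisCohomology.scalarMapH1 (S.T.ρ k) (S.T.hlin k) S.π).ker) := fun t ↦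
    { toFun := fun b ↦ ⟨galoisCohomology.scalarMapH1 (S.T.ρ k) (S.T.hlin k) (S.π ^ t)
          (b : galoisCohomology (S.T.ρ k) 1), S.scalarMapH1_pow_mem_inf_ker k t L hL b.2⟩
      map_zero' := Subtype.ext (by simp only [AddSubgroup.coe_zero, map_zero])
      map_add' := fun b b' ↦ Subtype.ext (by simp only [AddSubgroup.coe_add, map_add]) }
  have htoW : ∀ t (b : ↥(L ⊓ (galoisCohomology.scalarMapH1 (S.T.ρ k) (S.T.hlin k) (S.π ^ (t + 1))).ker)),
      (toW t b : galoisCohomology (S.T.ρ k) 1) =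
        galoisCohomology.scalarMapH1 (S.T.ρ k) (S.T.hlin k) (S.π ^ t) (b : galoisCohomology (S.T.ρ k) 1) :=
    fun t b ↦ rfl
  -- the forms
  refine ⟨fun t ↦ ((P t).flip.comp (toW t)).flip, ?_, ?_, ?_, ?_⟩
  · -- `R`-equivariance in the first slot
    intro t r x x' y hx'
    change P t x' (toW t y) = r • P t x (toW t y)
    exact hP₁ t r x x' (toW t y) hx'
  · -- `R`-equivariance in the second slot: `π^t (r y) = r (π^t y)`
    intro t r x y y' hy'
    change P t x (toW t y') = r • P t x (toW t y)
    refine hP₂ t r x (toW t y) (toW t y') ?_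
    rw [htoW, htoW, hy', S.scalarMapH1_comm]
  · -- alternating: `B(x,x) = -B(x,x)` and `2 ∈ R^×`
    intro t ht x
    change P t x (toW t x) = 0
    have h := hskew t ht x x (toW t x) (toW t x) (htoW t x) (htoW t x)
    have h2 : (2 : R) • P t x (toW t x) = 0 := by
      rw [two_smul]
      nth_rewrite 1 [h]
      exact neg_add_cancel _
    exact (htwo.smul_eq_zero).1 h2
  · -- the kernel
    intro t ht x
    have hskew' : ∀ y : ↥(L ⊓ (galoisCohomology.scalarMapH1 (S.T.ρ k) (S.T.hlin k) (S.π ^ (t + 1))).ker),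
        P t x (toW t y) = - P t y (toW t x) :=
      fun y ↦ hskew t ht x y (toW t x) (toW t y) (htoW t x) (htoW t y)
    change (∀ y, P t x (toW t y) = 0) ↔ _
    constructor
    · intro h
      -- `π^t x` lies in the right kernel of `P`
      have hker : ∀ y, P t y (toW t x) = 0 := fun y ↦ by
        have := hskew' y
        rw [h y] at this
        exact (neg_eq_zero.1 this.symm)
      obtain ⟨z, hz, hz0, hzx⟩ := (hright t ht (toW t x)).1 hker
      rw [htoW] at hzx
      obtain ⟨hx₁, -⟩ := AddSubgroup.mem_inf.1 x.2
      refine ⟨(x : galoisCohomology (S.T.ρ k) 1) -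
          galoisCohomology.scalarMapH1 (S.T.ρ k) (S.T.hlin k) S.π z,
        AddSubgroup.sub_mem _ hx₁ (hL _ hz), z, hz, ?_, hz0, ?_⟩
      · rw [map_sub, hzx, ← AddMonoidHom.comp_apply, ← galoisCohomology.scalarMapH1_mul, ← pow_succ,
          sub_self]
      · rw [sub_add_cancel]
    · rintro ⟨y, hy₁, z, hz₁, hy0, hz0, hxyz⟩ w
      -- `π^t x = π^{t+1} z` lies in the right kernel of `P`
      have hx : (toW t x : galoisCohomology (S.T.ρ k) 1) =
          galoisCohomology.scalarMapH1 (S.T.ρ k) (S.T.hlin k) (S.π ^ (t + 1)) z := by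
        rw [htoW, hxyz, map_add, hy0, zero_add, ← AddMonoidHom.comp_apply,
          ← galoisCohomology.scalarMapH1_mul, ← pow_succ]
      have hker : ∀ a, P t a (toW t x) = 0 := (hright t ht (toW t x)).2 ⟨z, hz₁, hz0, hx⟩
      rw [hskew' w, hker w, neg_zero]

/-- **HOWARD'S `⟨a, b⟩ = (a, π^{s-1} b)_{s,1}` IS AN ALTERNATING FORM WITH KERNEL `V_{s-1}`.** On a `DVRSetting`
with H.0–H.5 suppose that for every level `k` and every `t` there is a bi-additive pairing
`P_{k,t} : ℋ[π^{t+1}] × ℋ[π] → Q_{k,t}` (`ℋ = H¹_𝓕(K, T^{(k)})`, `ℋ[π^j] = Sel_k ⊓ ker π^j`), `R`-equivariant in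
both slots, such that for `t + 1 < e_k`: (right kernel) `P_{k,t}(·, w) = 0` iff `w = π^{t+1} z` for a Selmer class
`z` killed by `π^{t+2}` («nondegenerate on `W_s = ℋ[𝔪]/𝔪^sℋ[𝔪^{s+1}]`»), and (skew-symmetry)
`P_{k,t}(a, π^t b) = - P_{k,t}(b, π^t a)` («`(a, π^{s-1}b)_{s,1} = -(b, π^{s-1}a)_{s,1}`»). Then the forms
`B_{k,t}(a, b) := P_{k,t}(a, π^t b)` on `ℋ[π^{t+1}]` are `R`-equivariant, ALTERNATING (for `t + 1 < e_k`; via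
`2 ∈ R^×`) and have kernel EXACTLY `ℋ[π^t] + π·ℋ[π^{t+2}]` — the binders `B / hB₁ / hB₂ / halt / hker` of
`DVRSetting.exists_package_of_levelPairings`.
[cite: Howard2004HeegnerKolyvagin, Thm. 1.4.2 (proof) and Prop. 1.4.1 (arXiv:1202.6340 p0008 L83–L141)] -/
theorem exists_levelPairings_of_skewPairings (S : DVRSetting p K R N Rk Nbar Nq) (hy : S.SatisfiesH)
    {Q : ℕ → ℕ → Type} [∀ k t, AddCommGroup (Q k t)] [∀ k t, Module R (Q k t)]
    (P : ∀ k t, ↥(((S.t k).cond).selmerGroup ⊓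
        (galoisCohomology.scalarMapH1 (S.T.ρ k) (S.T.hlin k) (S.π ^ (t + 1))).ker) →+
      ↥(((S.t k).cond).selmerGroup ⊓
        (galoisCohomology.scalarMapH1 (S.T.ρ k) (S.T.hlin k) S.π).ker) →+ Q k t)
    (hP₁ : ∀ k t (r : R) (x x' : ↥(((S.t k).cond).selmerGroup ⊓
        (galoisCohomology.scalarMapH1 (S.T.ρ k) (S.T.hlin k) (S.π ^ (t + 1))).ker))
        (w : ↥(((S.t k).cond).selmerGroup ⊓
          (galoisCohomology.scalarMapH1 (S.T.ρ k) (S.T.hlin k) S.π).ker)),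
      (x' : galoisCohomology (S.T.ρ k) 1) =
        galoisCohomology.scalarMapH1 (S.T.ρ k) (S.T.hlin k) r (x : galoisCohomology (S.T.ρ k) 1) →
      P k t x' w = r • P k t x w)
    (hP₂ : ∀ k t (r : R) (x : ↥(((S.t k).cond).selmerGroup ⊓
        (galoisCohomology.scalarMapH1 (S.T.ρ k) (S.T.hlin k) (S.π ^ (t + 1))).ker))
        (w w' : ↥(((S.t k).cond).selmerGroup ⊓
          (galoisCohomology.scalarMapH1 (S.T.ρ k) (S.T.hlin k) S.π).ker)),
      (w' : galoisCohomology (S.T.ρ k) 1) =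
        galoisCohomology.scalarMapH1 (S.T.ρ k) (S.T.hlin k) r (w : galoisCohomology (S.T.ρ k) 1) →
      P k t x w' = r • P k t x w)
    (hright : ∀ k t, t + 1 < S.e k → ∀ w : ↥(((S.t k).cond).selmerGroup ⊓
        (galoisCohomology.scalarMapH1 (S.T.ρ k) (S.T.hlin k) S.π).ker),
      (∀ x, P k t x w = 0) ↔
        ∃ z ∈ ((S.t k).cond).selmerGroup,
          galoisCohomology.scalarMapH1 (S.T.ρ k) (S.T.hlin k) (S.π ^ (t + 2)) z = 0 ∧
          (w : galoisCohomology (S.T.ρ k) 1) =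
            galoisCohomology.scalarMapH1 (S.T.ρ k) (S.T.hlin k) (S.π ^ (t + 1)) z)
    (hskew : ∀ k t, t + 1 < S.e k → ∀ (a b : ↥(((S.t k).cond).selmerGroup ⊓
        (galoisCohomology.scalarMapH1 (S.T.ρ k) (S.T.hlin k) (S.π ^ (t + 1))).ker))
        (a' b' : ↥(((S.t k).cond).selmerGroup ⊓
          (galoisCohomology.scalarMapH1 (S.T.ρ k) (S.T.hlin k) S.π).ker)),
      (a' : galoisCohomology (S.T.ρ k) 1) =
        galoisCohomology.scalarMapH1 (S.T.ρ k) (S.T.hlin k) (S.π ^ t) (a : galoisCohomology (S.T.ρ k) 1) →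
      (b' : galoisCohomology (S.T.ρ k) 1) =
        galoisCohomology.scalarMapH1 (S.T.ρ k) (S.T.hlin k) (S.π ^ t) (b : galoisCohomology (S.T.ρ k) 1) →
      P k t a b' = - P k t b a') :
    ∃ B : ∀ k t, ↥(((S.t k).cond).selmerGroup ⊓
        (galoisCohomology.scalarMapH1 (S.T.ρ k) (S.T.hlin k) (S.π ^ (t + 1))).ker) →+
      ↥(((S.t k).cond).selmerGroup ⊓
        (galoisCohomology.scalarMapH1 (S.T.ρ k) (S.T.hlin k) (S.π ^ (t + 1))).ker) →+ Q k t,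
      (∀ k t (r : R) (x x' y : ↥(((S.t k).cond).selmerGroup ⊓
          (galoisCohomology.scalarMapH1 (S.T.ρ k) (S.T.hlin k) (S.π ^ (t + 1))).ker)),
        (x' : galoisCohomology (S.T.ρ k) 1) =
          galoisCohomology.scalarMapH1 (S.T.ρ k) (S.T.hlin k) r (x : galoisCohomology (S.T.ρ k) 1) →
        B k t x' y = r • B k t x y) ∧
      (∀ k t (r : R) (x y y' : ↥(((S.t k).cond).selmerGroup ⊓
          (galoisCohomology.scalarMapH1 (S.T.ρ k) (S.T.hlin k) (S.π ^ (t + 1))).ker)),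
        (y' : galoisCohomology (S.T.ρ k) 1) =
          galoisCohomology.scalarMapH1 (S.T.ρ k) (S.T.hlin k) r (y : galoisCohomology (S.T.ρ k) 1) →
        B k t x y' = r • B k t x y) ∧
      (∀ k t, t + 1 < S.e k → ∀ x, B k t x x = 0) ∧
      (∀ k t, t + 1 < S.e k → ∀ x : ↥(((S.t k).cond).selmerGroup ⊓
          (galoisCohomology.scalarMapH1 (S.T.ρ k) (S.T.hlin k) (S.π ^ (t + 1))).ker),
        (∀ y, B k t x y = 0) ↔
          ∃ y ∈ ((S.t k).cond).selmerGroup, ∃ z ∈ ((S.t k).cond).selmerGroup,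
            galoisCohomology.scalarMapH1 (S.T.ρ k) (S.T.hlin k) (S.π ^ t) y = 0 ∧
            galoisCohomology.scalarMapH1 (S.T.ρ k) (S.T.hlin k) (S.π ^ (t + 2)) z = 0 ∧
            (x : galoisCohomology (S.T.ρ k) 1) =
              y + galoisCohomology.scalarMapH1 (S.T.ρ k) (S.T.hlin k) S.π z) := by
  have h := fun k ↦ S.levelForms_of_skewPairings hy k ((S.t k).cond).selmerGroup
    (fun r _ hx ↦ S.scalarMapH1_mem_selmerGroup hy k r hx) (P k) (hP₁ k) (hP₂ k) (hright k) (hskew k)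
  choose B hB₁ hB₂ halt hker using h
  exact ⟨B, hB₁, hB₂, halt, hker⟩

/-! ## §3 The levelwise package and Thm. 1.6.1 from the skew pairings -/

/-- **THE LEVELWISE PACKAGE `H¹_𝓕(K, T^{(k)}) ≅ R^{(k),ε} ⊕ M^{(k)} ⊕ M^{(k)}` FROM HOWARD'S SKEW PAIRINGS
`( , )_{s,1}`.** On a `DVRSetting` with H.0–H.5, given for every level `k` and `s = t + 1 < e_k` the
`R`-equivariant pairing `P_{k,t} : ℋ[π^{t+1}] × ℋ[π] → Q_{k,t}` (`Q_{k,t}` with cyclic `π`-torsion) with right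
kernel exactly `π^{t+1}·ℋ[π^{t+2}]` and the skew-symmetry `P(a, π^t b) = -P(b, π^t a)` (Prop. 1.4.1 + the display
of the proof of Thm. 1.4.2), there are ONE `ε ≤ 1`, exponents `1 ≤ n_{k,j} ≤ e_k` and additive `R`-equivariant
`θ_k : H¹_𝓕(K, T^{(k)}) ≃ (R/𝔪^{e_k})^ε × (M_k × M_k)`, `M_k = Π_j R/(π^{n_{k,j}})` — the binders of
`DVRSetting.conclusion_of_package`. (`exists_package_of_levelPairings` ∘ §2; the level Selmer groups are finite by
`finite_selmerGroup`.)
[cite: Howard2004HeegnerKolyvagin, Thm. 1.4.2, Prop. 1.4.1, Prop. 1.5.5, Thm. 1.6.1 (proof) (arXiv:1202.6340 p0008 L83–L141, p0010 L67–75, p0011 L39–46)] -/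
theorem exists_package_of_skewPairings (S : DVRSetting p K R N Rk Nbar Nq) (hy : S.SatisfiesH)
    {Q : ℕ → ℕ → Type} [∀ k t, AddCommGroup (Q k t)] [∀ k t, Module R (Q k t)]
    (hQ : ∀ k t (a b : Q k t), S.π • a = 0 → S.π • b = 0 → a ≠ 0 → ∃ r : R, b = r • a)
    (P : ∀ k t, ↥(((S.t k).cond).selmerGroup ⊓
        (galoisCohomology.scalarMapH1 (S.T.ρ k) (S.T.hlin k) (S.π ^ (t + 1))).ker) →+
      ↥(((S.t k).cond).selmerGroup ⊓
        (galoisCohomology.scalarMapH1 (S.T.ρ k) (S.T.hlin k) S.π).ker) →+ Q k t)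
    (hP₁ : ∀ k t (r : R) (x x' : ↥(((S.t k).cond).selmerGroup ⊓
        (galoisCohomology.scalarMapH1 (S.T.ρ k) (S.T.hlin k) (S.π ^ (t + 1))).ker))
        (w : ↥(((S.t k).cond).selmerGroup ⊓
          (galoisCohomology.scalarMapH1 (S.T.ρ k) (S.T.hlin k) S.π).ker)),
      (x' : galoisCohomology (S.T.ρ k) 1) =
        galoisCohomology.scalarMapH1 (S.T.ρ k) (S.T.hlin k) r (x : galoisCohomology (S.T.ρ k) 1) →
      P k t x' w = r • P k t x w)
    (hP₂ : ∀ k t (r : R) (x : ↥(((S.t k).cond).selmerGroup ⊓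
        (galoisCohomology.scalarMapH1 (S.T.ρ k) (S.T.hlin k) (S.π ^ (t + 1))).ker))
        (w w' : ↥(((S.t k).cond).selmerGroup ⊓
          (galoisCohomology.scalarMapH1 (S.T.ρ k) (S.T.hlin k) S.π).ker)),
      (w' : galoisCohomology (S.T.ρ k) 1) =
        galoisCohomology.scalarMapH1 (S.T.ρ k) (S.T.hlin k) r (w : galoisCohomology (S.T.ρ k) 1) →
      P k t x w' = r • P k t x w)
    (hright : ∀ k t, t + 1 < S.e k → ∀ w : ↥(((S.t k).cond).selmerGroup ⊓
        (galoisCohomology.scalarMapH1 (S.T.ρ k) (S.T.hlin k) S.π).ker),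
      (∀ x, P k t x w = 0) ↔
        ∃ z ∈ ((S.t k).cond).selmerGroup,
          galoisCohomology.scalarMapH1 (S.T.ρ k) (S.T.hlin k) (S.π ^ (t + 2)) z = 0 ∧
          (w : galoisCohomology (S.T.ρ k) 1) =
            galoisCohomology.scalarMapH1 (S.T.ρ k) (S.T.hlin k) (S.π ^ (t + 1)) z)
    (hskew : ∀ k t, t + 1 < S.e k → ∀ (a b : ↥(((S.t k).cond).selmerGroup ⊓
        (galoisCohomology.scalarMapH1 (S.T.ρ k) (S.T.hlin k) (S.π ^ (t + 1))).ker))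
        (a' b' : ↥(((S.t k).cond).selmerGroup ⊓
          (galoisCohomology.scalarMapH1 (S.T.ρ k) (S.T.hlin k) S.π).ker)),
      (a' : galoisCohomology (S.T.ρ k) 1) =
        galoisCohomology.scalarMapH1 (S.T.ρ k) (S.T.hlin k) (S.π ^ t) (a : galoisCohomology (S.T.ρ k) 1) →
      (b' : galoisCohomology (S.T.ρ k) 1) =
        galoisCohomology.scalarMapH1 (S.T.ρ k) (S.T.hlin k) (S.π ^ t) (b : galoisCohomology (S.T.ρ k) 1) →
      P k t a b' = - P k t b a') :
    ∃ (ε : ℕ) (m : ℕ → ℕ) (n : ∀ k, Fin (m k) → ℕ), ε ≤ 1 ∧ (∀ k j, 1 ≤ n k j ∧ n k j ≤ S.e k) ∧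
      ∀ k, ∃ θ : ↥((S.t k).cond).selmerGroup ≃+
          ((Fin ε → R ⧸ IsLocalRing.maximalIdeal R ^ S.e k) ×
            ((Π j, R ⧸ Ideal.span {S.π ^ n k j}) × (Π j, R ⧸ Ideal.span {S.π ^ n k j}))),
        ∀ (r : R) (y : galoisCohomology (S.T.ρ k) 1) (hy' : y ∈ ((S.t k).cond).selmerGroup),
          θ ⟨galoisCohomology.scalarMapH1 (S.T.ρ k) (S.T.hlin k) r y,
              S.scalarMapH1_mem_selmerGroup hy k r hy'⟩ = r • θ ⟨y, hy'⟩ := by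
  obtain ⟨B, hB₁, hB₂, halt, hker⟩ := S.exists_levelPairings_of_skewPairings hy P hP₁ hP₂ hright hskew
  exact S.exists_package_of_levelPairings hy (fun k ↦ S.finite_selmerGroup hy k) hQ B hB₁ hB₂ halt hker

/-- **HOWARD 2004, THM. 1.6.1 FROM THE SKEW PAIRINGS `( , )_{s,1}` + LEMMA 1.6.4@1 + `κ_1 ≠ 0`.** The conclusion
record `S.Conclusion hy κ.one` ((i) `H¹_𝓕(K, T)` free of rank one; (ii) `H¹_𝓕(K, A) ≅ 𝒟 ⊕ M ⊕ M`; (iii)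
`len M ≤ len(H¹_𝓕(K, T)/R·κ_1)`) on a `DVRSetting` with H.0–H.5, from: for every level `k` and `s = t + 1 < e_k`
the `R`-equivariant pairing `P_{k,t} : ℋ[π^{t+1}] × ℋ[π] → Q_{k,t}` of Prop. 1.4.1 («`( , )_{s,1} : V_s × W_s →
R[𝔪]`», `Q_{k,t}` with cyclic `π`-torsion) with right kernel exactly `π^{t+1}·ℋ[π^{t+2}]` and the skew-symmetry
«`(a, π^{s-1}b)_{s,1} = -(b, π^{s-1}a)_{s,1}`»; Lemma 1.6.4 at `n = 1` for ANY admissible decomposition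
(«`κ_1^{(k)} ∈ Stub^{(k)} = 𝔪^{len M^{(k)}} H¹_𝓕(K, T^{(k)})`»); and `κ_1 ≠ 0`. The level Selmer groups are finite
by `finite_selmerGroup`; then `conclusion_of_levelPairings` ∘ `exists_levelPairings_of_skewPairings`.
[cite: Howard2004HeegnerKolyvagin, Thm. 1.6.1 and its proof, Thm. 1.4.2 (proof), Prop. 1.4.1 (arXiv:1202.6340 Thm. 2.6.1 p0011 L23–28, p0012 L29–55; p0008 L83–L141)] -/
theorem conclusion_of_skewPairings (S : DVRSetting p K R N Rk Nbar Nq) (κ : S.KolyvaginSystem)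
    (hy : S.SatisfiesH)
    {Q : ℕ → ℕ → Type} [∀ k t, AddCommGroup (Q k t)] [∀ k t, Module R (Q k t)]
    (hQ : ∀ k t (a b : Q k t), S.π • a = 0 → S.π • b = 0 → a ≠ 0 → ∃ r : R, b = r • a)
    (P : ∀ k t, ↥(((S.t k).cond).selmerGroup ⊓
        (galoisCohomology.scalarMapH1 (S.T.ρ k) (S.T.hlin k) (S.π ^ (t + 1))).ker) →+
      ↥(((S.t k).cond).selmerGroup ⊓
        (galoisCohomology.scalarMapH1 (S.T.ρ k) (S.T.hlin k) S.π).ker) →+ Q k t)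
    (hP₁ : ∀ k t (r : R) (x x' : ↥(((S.t k).cond).selmerGroup ⊓
        (galoisCohomology.scalarMapH1 (S.T.ρ k) (S.T.hlin k) (S.π ^ (t + 1))).ker))
        (w : ↥(((S.t k).cond).selmerGroup ⊓
          (galoisCohomology.scalarMapH1 (S.T.ρ k) (S.T.hlin k) S.π).ker)),
      (x' : galoisCohomology (S.T.ρ k) 1) =
        galoisCohomology.scalarMapH1 (S.T.ρ k) (S.T.hlin k) r (x : galoisCohomology (S.T.ρ k) 1) →
      P k t x' w = r • P k t x w)
    (hP₂ : ∀ k t (r : R) (x : ↥(((S.t k).cond).selmerGroup ⊓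
        (galoisCohomology.scalarMapH1 (S.T.ρ k) (S.T.hlin k) (S.π ^ (t + 1))).ker))
        (w w' : ↥(((S.t k).cond).selmerGroup ⊓
          (galoisCohomology.scalarMapH1 (S.T.ρ k) (S.T.hlin k) S.π).ker)),
      (w' : galoisCohomology (S.T.ρ k) 1) =
        galoisCohomology.scalarMapH1 (S.T.ρ k) (S.T.hlin k) r (w : galoisCohomology (S.T.ρ k) 1) →
      P k t x w' = r • P k t x w)
    (hright : ∀ k t, t + 1 < S.e k → ∀ w : ↥(((S.t k).cond).selmerGroup ⊓
        (galoisCohomology.scalarMapH1 (S.T.ρ k) (S.T.hlin k) S.π).ker),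
      (∀ x, P k t x w = 0) ↔
        ∃ z ∈ ((S.t k).cond).selmerGroup,
          galoisCohomology.scalarMapH1 (S.T.ρ k) (S.T.hlin k) (S.π ^ (t + 2)) z = 0 ∧
          (w : galoisCohomology (S.T.ρ k) 1) =
            galoisCohomology.scalarMapH1 (S.T.ρ k) (S.T.hlin k) (S.π ^ (t + 1)) z)
    (hskew : ∀ k t, t + 1 < S.e k → ∀ (a b : ↥(((S.t k).cond).selmerGroup ⊓
        (galoisCohomology.scalarMapH1 (S.T.ρ k) (S.T.hlin k) (S.π ^ (t + 1))).ker))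
        (a' b' : ↥(((S.t k).cond).selmerGroup ⊓
          (galoisCohomology.scalarMapH1 (S.T.ρ k) (S.T.hlin k) S.π).ker)),
      (a' : galoisCohomology (S.T.ρ k) 1) =
        galoisCohomology.scalarMapH1 (S.T.ρ k) (S.T.hlin k) (S.π ^ t) (a : galoisCohomology (S.T.ρ k) 1) →
      (b' : galoisCohomology (S.T.ρ k) 1) =
        galoisCohomology.scalarMapH1 (S.T.ρ k) (S.T.hlin k) (S.π ^ t) (b : galoisCohomology (S.T.ρ k) 1) →
      P k t a b' = - P k t b a')
    (h164 : ∀ k (ε : ℕ), ε ≤ 1 → ∀ (M : Type) [AddCommGroup M] [Module R M] [Finite M]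
      (θ : ↥((S.t k).cond).selmerGroup ≃+ ((Fin ε → R ⧸ IsLocalRing.maximalIdeal R ^ S.e k) × (M × M))),
      (∀ (r : R) (y : galoisCohomology (S.T.ρ k) 1) (hy' : y ∈ ((S.t k).cond).selmerGroup),
        θ ⟨galoisCohomology.scalarMapH1 (S.T.ρ k) (S.T.hlin k) r y,
          S.scalarMapH1_mem_selmerGroup hy k r hy'⟩ = r • θ ⟨y, hy'⟩) →
      ∃ y ∈ ((S.t k).cond).selmerGroup,
        κ.one k = galoisCohomology.scalarMapH1 (S.T.ρ k) (S.T.hlin k)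
          (S.π ^ (Module.length R M).toNat) y)
    (hone : κ.one ≠ 0) : S.Conclusion hy κ.one := by
  obtain ⟨B, hB₁, hB₂, halt, hker⟩ := S.exists_levelPairings_of_skewPairings hy P hP₁ hP₂ hright hskew
  exact S.conclusion_of_levelPairings κ hy (fun k ↦ S.finite_selmerGroup hy k) hQ B hB₁ hB₂ halt hker h164
    hone

end DVRSetting

end Literature.NumberTheory.GaloisCohomology.Howard2004
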